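import Mathlib.Algebra.MvPolynomial.PDeriv
import Mathlib.RingTheory.MvPolynomial.Homogeneous
import Mathlib.RingTheory.MvPolynomial.EulerIdentity
import Literature.NumberTheory.Transcendental.ExpVarieties
import Literature.ModelTheory.ExponentialFields.Languages
import Summits.Schanuel.Schanuel.Theorems.ZilberEacComplexSecondOrder
import Summits.Schanuel.Schanuel.Theorems.ZilberEacComplexBranchPuncture
import HarnessLib

/-!
# Exponential points over oscillatory graph bases: the varieties and two model systems

Fourth file of the "oscillatory base" sub-rung of Zilber's Exponential-Algebraic Closedness
(first open rung `dim π₁(V) = n - 1`, Mantova–Masser, PLMS 129 (2024), §1 p. 5).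

* `exists_solution_oscillatory_avoiding` — **Zariski density over the base**: if `Re g_D` vanishes
  at every lattice direction (the structural oscillatory class), `Aⱼ ≠ 0`, and `κ(q₀) < 0` at one
  direction, the solutions avoid any hypersurface `h = 0`;
* `oscillatory_inter_expGraph_nonempty` — the `(s+1)`-fold
  `V = {x_{s+1} = g(x'), yⱼ = Aⱼ(x') + y_{s+1} Fⱼ(y_{s+1}, x')} ⊆ ℂ^{s+1} × (ℂˣ)^{s+1}` meets
  `Literature.NumberTheory.Transcendental.expGraph` under the second-order sign condition of
  `exists_expPoint_of_oscillatory` (EC vocabulary);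
* `mantovaMasser_cubic_model_system_solvable` — `∃ z w, e^z + e^{z³+w³} = z ∧ e^w + e^{z³+w³} = -w`,
  the cubic analogue of Mantova–Masser's displayed model system `e^z + e^{z²-w²} = z`,
  `e^w + e^{z²-w²} = -w` (p. 5); here `Re (z³+w³)|_{2πi ℤ²} ≡ 0`, so no earlier theorem of the
  ladder applies;
* `imaginary_quadric_model_system_solvable` — `∃ z w, e^z + e^{i z w} = z ∧ e^w + e^{i z w} = w`
  (even degree, imaginary leading form).

HONEST FRAMING: modest new cases of EAC; nothing here bears on Schanuel's conjecture.
-/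

noncomputable section

open Complex MvPolynomial Metric Set Filter Topology

set_option linter.dupNamespace false

namespace Summit.Schanuel.Schanuel.Theorems

/-! ### Solvability and the EC vocabulary -/

/-- **Solvability** of the oscillatory systems: under the hypotheses of
`exists_expPoint_of_oscillatory` (`deg g ≥ 2`, `Re g_D(2πi q) = 0`, `(Aⱼ)_{dⱼ}(2πi q) ≠ 0`,
`Σⱼ dⱼ Re(∂ⱼ g_D)(2πi q) < 0`), the system `exp xⱼ = Aⱼ(x) + e^{g(x)} Fⱼ(e^{g(x)}, x)` (`j ≤ s`)
has a solution in `ℂˢ`. [cite: MantovaMasser2023, §1 p.5 (the open case dim π(V) = 2 in ℂ³×ℂˣ³)] -/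
theorem exists_solution_oscillatory {s : ℕ} (g : MvPolynomial (Fin s) ℂ)
    (hD : 2 ≤ g.totalDegree) (q : Fin s → ℤ)
    (hre : (eval (fun j => 2 * Real.pi * I * (q j : ℂ))
      (homogeneousComponent g.totalDegree g)).re = 0)
    (A : Fin s → MvPolynomial (Fin s) ℂ)
    (hA : ∀ j, eval (fun i => 2 * Real.pi * I * (q i : ℂ))
      (homogeneousComponent (A j).totalDegree (A j)) ≠ 0)
    (hκ : ∑ j, ((A j).totalDegree : ℝ) * (eval (fun i => 2 * Real.pi * I * (q i : ℂ))
      (pderiv j (homogeneousComponent g.totalDegree g))).re < 0)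
    (F : Fin s → MvPolynomial (Fin (s + 1)) ℂ) :
    ∃ x : Fin s → ℂ, ∀ j, exp (x j) = eval x (A j) +
        exp (eval x g) * eval (Fin.cons (exp (eval x g)) x) (F j) := by
  obtain ⟨m, x, -, hx⟩ := (exists_expPoint_of_oscillatory g hD q hre A hA hκ F).exists
  exact ⟨x, hx⟩

/-- **Zariski density of the solutions over the base (oscillatory class).** Let `deg g = D ≥ 2`
with `Re g_D(2πi q) = 0` for EVERY `q ∈ ℤˢ` (e.g. `i^D g_D` real on `ℝˢ`), `Aⱼ ∈ ℂ[x'] ∖ 0`,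
`Fⱼ ∈ ℂ[u, x']`, and suppose `κ(q₀) = Σⱼ deg(Aⱼ) Re(∂ⱼ g_D)(2πi q₀) < 0` for one `q₀`. Then for
every `h ≠ 0` the system `exp xⱼ = Aⱼ(x) + e^{g(x)} Fⱼ(e^{g(x)}, x)` has a solution with
`h(x) ≠ 0`: the solutions are Zariski dense in `ℂˢ`, i.e. the exponential points of
`V = {x_{s+1} = g, yⱼ = Aⱼ + y_{s+1}Fⱼ}` project to a Zariski-dense subset of the base. Proof:
`κ < 0` is an open dilation-stable cone condition (`∂ⱼ g_D` is a form of degree `D - 1`), so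
`exists_good_direction_of_isOpen_cone` gives a direction `q` with `κ(q) < 0` off the hypersurface
`(Πⱼ (Aⱼ)_{dⱼ}) · h_top = 0`; near the lattice centres of `q` the solutions of
`exists_expPoint_of_oscillatory` satisfy `|h(x)| ≥ ½ |h_top(2πi q)| m^{deg h} > 0`. New.
[cite: MantovaMasser2023, §1 p.5 (the open case dim π(V) = 2 in ℂ³×ℂˣ³)] -/
theorem exists_solution_oscillatory_avoiding {s : ℕ} (g : MvPolynomial (Fin s) ℂ)
    (hD : 2 ≤ g.totalDegree)
    (hosc : ∀ q : Fin s → ℤ, (eval (fun j => 2 * Real.pi * I * (q j : ℂ))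
      (homogeneousComponent g.totalDegree g)).re = 0)
    (A : Fin s → MvPolynomial (Fin s) ℂ) (hA0 : ∀ j, A j ≠ 0) (q₀ : Fin s → ℤ)
    (hκ : ∑ j, ((A j).totalDegree : ℝ) * (eval (fun i => 2 * Real.pi * I * (q₀ i : ℂ))
      (pderiv j (homogeneousComponent g.totalDegree g))).re < 0)
    (F : Fin s → MvPolynomial (Fin (s + 1)) ℂ) (h : MvPolynomial (Fin s) ℂ) (hh : h ≠ 0) :
    ∃ x : Fin s → ℂ, eval x h ≠ 0 ∧ ∀ j, exp (x j) = eval x (A j) +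
        exp (eval x g) * eval (Fin.cons (exp (eval x g)) x) (F j) := by
  classical
  set D := g.totalDegree with hDdef
  set gD := homogeneousComponent D g with hgD
  have hgDhom : gD.IsHomogeneous D := homogeneousComponent_isHomogeneous D g
  -- the polynomial to avoid: product of the leading forms of the `A j` and of `h`
  set hT := homogeneousComponent h.totalDegree h with hhT
  set Q : MvPolynomial (Fin s) ℂ := (∏ j, homogeneousComponent (A j).totalDegree (A j)) * hT with hQ
  have hQ0 : Q ≠ 0 := by
    refine mul_ne_zero (Finset.prod_ne_zero_iff.mpr fun j _ => ?_)
      (Literature.NumberTheory.Transcendental.ExpDominant.homogeneousComponent_totalDegree_ne_zero hh)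
    exact Literature.NumberTheory.Transcendental.ExpDominant.homogeneousComponent_totalDegree_ne_zero
      (hA0 j)
  -- the cone `κ < 0`
  set κf : (Fin s → ℂ) → ℝ := fun w =>
    ∑ j, ((A j).totalDegree : ℝ) * (eval w (pderiv j gD)).re with hκf
  have hopen : IsOpen {w : Fin s → ℂ | κf w < 0} := by
    have hc : Continuous κf := by
      refine continuous_finsetSum _ fun j _ => continuous_const.mul ?_
      exact Complex.continuous_re.comp (MvPolynomial.continuous_eval _)
    exact isOpen_lt hc continuous_const
  have hcone : ∀ t : ℝ, 0 < t → ∀ w, κf w < 0 → κf ((t : ℂ) • w) < 0 := by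
    intro t ht w hw
    have hscale : κf ((t : ℂ) • w) = t ^ (D - 1) * κf w := by
      simp only [hκf, Finset.mul_sum]
      refine Finset.sum_congr rfl fun j _ => ?_
      rw [(hgDhom.pderiv (i := j)).eval_smul_eq, show ((t : ℂ) ^ (D - 1)) = ((t ^ (D - 1) : ℝ) : ℂ) by
        push_cast; rfl, Complex.re_ofReal_mul]
      ring
    rw [hscale]
    exact mul_neg_of_pos_of_neg (pow_pos ht _) hw
  obtain ⟨q, hqQ, hq⟩ := exists_good_direction_of_isOpen_cone Q hQ0 (fun w => κf w < 0) hopen hcone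
    q₀ hκ
  set v : Fin s → ℂ := fun j => 2 * Real.pi * I * (q j : ℂ) with hv
  rw [hQ, map_mul, map_prod] at hqQ
  have hA : ∀ j, eval v (homogeneousComponent (A j).totalDegree (A j)) ≠ 0 := fun j =>
    (Finset.prod_ne_zero_iff.mp (left_ne_zero_of_mul hqQ)) j (Finset.mem_univ j)
  have hqh : eval v hT ≠ 0 := right_ne_zero_of_mul hqQ
  -- solutions near the lattice centres of `q`, eventually
  have hsol := exists_expPoint_of_oscillatory g hD q (hosc q) A hA hq F
  -- `h ≠ 0` on the unit polydiscs around the lattice centres, eventually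
  have hεh : 0 < ‖eval v hT‖ / 2 := by positivity
  obtain ⟨ρ, hρ, t₀, ht₀, hnear⟩ := eval_near_natMul_add h v hεh
  have hev := (hsol.and ((eventually_norm_log_latticeValue_le A v hA hρ).and
    (tendsto_natCast_atTop_atTop.eventually_ge_atTop t₀))).exists
  obtain ⟨m, ⟨x, hxd, hx⟩, hmℓ, hmt⟩ := hev
  refine ⟨x, ?_, hx⟩
  have hm0 : (0 : ℝ) < m := by linarith
  set η : Fin s → ℂ := x - (fun i => (m : ℂ) * v i) with hη
  have hxη : x = (fun i => (m : ℂ) * v i) + η := by rw [hη]; abel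
  have hηle : ‖η‖ ≤ ρ * m := by
    have h1 : η = (x - fun i => (m : ℂ) * v i + log (eval (fun k => (m : ℂ) * v k) (A i))) +
        fun i => log (eval (fun k => (m : ℂ) * v k) (A i)) := by
      funext i; simp only [hη, Pi.sub_apply, Pi.add_apply]; ring
    rw [h1]
    refine (norm_add_le _ _).trans ?_
    linarith
  have hh' := hnear m hmt η hηle
  rw [← hxη] at hh'
  intro hzero
  rw [hzero, zero_sub, norm_neg, norm_mul, norm_pow, Complex.norm_natCast] at hh'
  have hmd : (0 : ℝ) < (m : ℝ) ^ h.totalDegree := by positivity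
  have : ‖eval v hT‖ ≤ ‖eval v hT‖ / 2 := le_of_mul_le_mul_left (by linarith [hh']) hmd
  have hpos : 0 < ‖eval v hT‖ := norm_pos_iff.mpr hqh
  linarith

/-- **The oscillatory varieties meet the graph of exponentiation** (Exponential-Algebraic
Closedness for this class, in the vocabulary of `Literature.NumberTheory.Transcendental.expGraph`):
with `n = s + 1`, under the hypotheses of `exists_expPoint_of_oscillatory` the subvariety
`V = {xₙ = g(x₁..xₛ), yⱼ = Aⱼ(x₁..xₛ) + yₙ Fⱼ(yₙ, x₁..xₛ) (j ≤ s)}` of `ℂⁿ × ℂⁿ` (points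
`z : Fin n ⊕ Fin n → ℂ`, additive block `inl`, multiplicative block `inr`, distinguished last
coordinate `Fin.last s`) contains a point of the graph of `exp`, hence of `ℂⁿ × (ℂˣ)ⁿ`. Its
additive projection is the graph hypersurface `xₙ = g` (dimension `n - 1`), and for `deg g ≥ 2`
with `i^{deg g} g_D(ℝˢ) ⊆ iℝ` no lattice direction has `Re g_D(2πi q) ≠ 0`, so none of
`punctureDecoupling_inter_expGraph_nonempty`, `punctureBM_inter_expGraph_nonempty`,
`cornerBM_inter_expGraph_nonempty` applies. [cite: MantovaMasser2023, §1 p.5 (the open case dim π(V) = 2 in ℂ³×ℂˣ³)] -/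
theorem oscillatory_inter_expGraph_nonempty {s : ℕ} (g : MvPolynomial (Fin s) ℂ)
    (hD : 2 ≤ g.totalDegree) (q : Fin s → ℤ)
    (hre : (eval (fun j => 2 * Real.pi * I * (q j : ℂ))
      (homogeneousComponent g.totalDegree g)).re = 0)
    (A : Fin s → MvPolynomial (Fin s) ℂ)
    (hA : ∀ j, eval (fun i => 2 * Real.pi * I * (q i : ℂ))
      (homogeneousComponent (A j).totalDegree (A j)) ≠ 0)
    (hκ : ∑ j, ((A j).totalDegree : ℝ) * (eval (fun i => 2 * Real.pi * I * (q i : ℂ))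
      (pderiv j (homogeneousComponent g.totalDegree g))).re < 0)
    (F : Fin s → MvPolynomial (Fin (s + 1)) ℂ) :
    ({z : Fin (s + 1) ⊕ Fin (s + 1) → ℂ |
        z (Sum.inl (Fin.last s)) = eval (fun j => z (Sum.inl (Fin.castSucc j))) g ∧
        ∀ j : Fin s, z (Sum.inr (Fin.castSucc j)) =
          eval (fun i => z (Sum.inl (Fin.castSucc i))) (A j) +
            z (Sum.inr (Fin.last s)) *
              eval (Fin.cons (z (Sum.inr (Fin.last s))) fun i => z (Sum.inl (Fin.castSucc i)))
                (F j)} ∩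
      Literature.NumberTheory.Transcendental.expGraph ℂ (s + 1)).Nonempty := by
  obtain ⟨x, hx⟩ := exists_solution_oscillatory g hD q hre A hA hκ F
  set X : Fin (s + 1) → ℂ := Fin.snoc x (eval x g) with hX
  refine ⟨Sum.elim X fun i => exp (X i), ⟨?_, fun j => ?_⟩, fun i => ?_⟩
  · simp [hX, Fin.snoc_last, Fin.snoc_castSucc]
  · simp only [Sum.elim_inl, Sum.elim_inr, hX, Fin.snoc_castSucc, Fin.snoc_last]
    exact hx j
  · simp [Literature.ModelTheory.ExponentialFields.ExponentialRing.complex_exp_eq]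

/-! ### Two model systems -/

/-- `(2πi)² = -4π²` as a real number cast. [folklore] -/
theorem twoPiI_sq : (2 * (Real.pi : ℂ) * I) ^ 2 = ((-4 * Real.pi ^ 2 : ℝ) : ℂ) := by
  push_cast
  ring_nf
  rw [Complex.I_sq]
  ring

/-- `(2πi)³ = -8π³ i`. [folklore] -/
theorem twoPiI_pow_three : (2 * (Real.pi : ℂ) * I) ^ 3 = ((-8 * Real.pi ^ 3 : ℝ) : ℂ) * I := by
  push_cast
  ring_nf
  rw [Complex.I_pow_three]
  ring

/-- **The cubic analogue of Mantova–Masser's model system is solvable**: there are `z, w ∈ ℂ`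
with `e^z + e^{z³+w³} = z` and `e^w + e^{z³+w³} = -w`. Mantova–Masser (PLMS 129 (2024), §1
p. 5) display `e^z + e^{z²-w²} = z, e^w + e^{z²-w²} = -w` for the first open case of
Exponential-Algebraic Closedness (`dim π(V) = 2` in `ℂ³ × ℂˣ³`); that system falls under the
sign condition `Re g₂(2πi q) < 0` (`mantovaMasser_model_system_solvable`). For `g = z³ + w³`
one has `Re g₃(2πi q) = Re(-8π³ i (q₁³ + q₂³)) = 0` for every `q ∈ ℤ²`, so only the second-order
theorem applies: `q = (1,1)`, `A₁ = z`, `A₂ = -w`, `F₁ = F₂ = -1`,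
`κ = Re ∂₁g₃(2πi q) + Re ∂₂g₃(2πi q) = -24π² < 0`. New.
[cite: MantovaMasser2023, §1 p.5 (displayed system for dim π(V) = 2 in ℂ³×ℂˣ³)] -/
theorem mantovaMasser_cubic_model_system_solvable :
    ∃ z w : ℂ, exp z + exp (z ^ 3 + w ^ 3) = z ∧ exp w + exp (z ^ 3 + w ^ 3) = -w := by
  set g : MvPolynomial (Fin 2) ℂ := X 0 ^ 3 + X 1 ^ 3 with hg
  have hhom : g.IsHomogeneous 3 := (isHomogeneous_X_pow 0 3).add (isHomogeneous_X_pow 1 3)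
  have heval : ∀ x : Fin 2 → ℂ, eval x g = x 0 ^ 3 + x 1 ^ 3 := fun x => by
    simp [hg, map_add, map_pow, eval_X]
  have hg0 : g ≠ 0 := by
    intro h
    have := heval ![1, 0]
    rw [h, map_zero] at this
    norm_num at this
  have hdeg : g.totalDegree = 3 := hhom.totalDegree hg0
  set q : Fin 2 → ℤ := ![1, 1] with hq
  have hv : (fun j : Fin 2 => 2 * (Real.pi : ℂ) * I * ((q j : ℤ) : ℂ)) =
      fun _ => 2 * Real.pi * I := by
    funext j; fin_cases j <;> simp [hq]
  -- the fibre polynomials `A₁ = x₁`, `A₂ = -x₂`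
  set A : Fin 2 → MvPolynomial (Fin 2) ℂ := ![X 0, -X 1] with hAdef
  have hA0 : A 0 = X 0 := by simp [hAdef]
  have hA1 : A 1 = -X 1 := by simp [hAdef]
  have hdegA0 : (A 0).totalDegree = 1 := by rw [hA0, totalDegree_X]
  have hdegA1 : (A 1).totalDegree = 1 := by rw [hA1, totalDegree_neg, totalDegree_X]
  have hA : ∀ j, eval (fun i => 2 * Real.pi * I * ((q i : ℤ) : ℂ))
      (homogeneousComponent (A j).totalDegree (A j)) ≠ 0 := by
    rw [hv]
    refine Fin.forall_fin_two.mpr ⟨?_, ?_⟩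
    · rw [hdegA0, hA0, homogeneousComponent_eq_self (isHomogeneous_X ℂ 0), eval_X]
      exact Complex.two_pi_I_ne_zero
    · rw [hdegA1, hA1, homogeneousComponent_eq_self (isHomogeneous_X ℂ 1).neg, map_neg, eval_X]
      exact neg_ne_zero.mpr Complex.two_pi_I_ne_zero
  -- `Re g₃(2πi q) = 0`
  have hre : (eval (fun j => 2 * Real.pi * I * ((q j : ℤ) : ℂ))
      (homogeneousComponent g.totalDegree g)).re = 0 := by
    rw [hv, hdeg, homogeneousComponent_eq_self hhom, heval, twoPiI_pow_three, Complex.add_re,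
      Complex.re_ofReal_mul, Complex.I_re, mul_zero, add_zero]
  -- the partial derivatives of `g` at `2πi q`
  have hpd0 : eval (fun _ : Fin 2 => 2 * (Real.pi : ℂ) * I) (pderiv 0 g) =
      3 * (2 * Real.pi * I) ^ 2 := by
    have h : pderiv 0 g = 3 * X 0 ^ 2 := by
      rw [hg, map_add, pderiv_pow, pderiv_pow, pderiv_X_self,
        pderiv_X_of_ne (show (1 : Fin 2) ≠ 0 by decide)]
      simp
    rw [h, map_mul, map_pow, eval_X]
    simp
  have hpd1 : eval (fun _ : Fin 2 => 2 * (Real.pi : ℂ) * I) (pderiv 1 g) =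
      3 * (2 * Real.pi * I) ^ 2 := by
    have h : pderiv 1 g = 3 * X 1 ^ 2 := by
      rw [hg, map_add, pderiv_pow, pderiv_pow, pderiv_X_self,
        pderiv_X_of_ne (show (0 : Fin 2) ≠ 1 by decide)]
      simp
    rw [h, map_mul, map_pow, eval_X]
    simp
  -- the second-order sign condition: `κ = -24π² < 0`
  have h3re : ((3 : ℂ) * (2 * Real.pi * I) ^ 2).re = -12 * Real.pi ^ 2 := by
    rw [twoPiI_sq, show (3 : ℂ) = ((3 : ℝ) : ℂ) by norm_num, ← Complex.ofReal_mul,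
      Complex.ofReal_re]
    ring
  have hκ : ∑ j, ((A j).totalDegree : ℝ) * (eval (fun i => 2 * Real.pi * I * ((q i : ℤ) : ℂ))
      (pderiv j (homogeneousComponent g.totalDegree g))).re < 0 := by
    rw [hv, hdeg, homogeneousComponent_eq_self hhom, Fin.sum_univ_two, hdegA0, hdegA1, hpd0,
      hpd1, h3re]
    have := Real.pi_pos
    push_cast
    nlinarith
  obtain ⟨x, hx⟩ := exists_solution_oscillatory g (by rw [hdeg]; norm_num) q hre A hA hκ
    (fun _ => C (-1))
  refine ⟨x 0, x 1, ?_, ?_⟩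
  · have h := hx 0
    rw [heval, eval_C, hA0, eval_X] at h
    linear_combination h
  · have h := hx 1
    rw [heval, eval_C, hA1, map_neg, eval_X] at h
    linear_combination h

/-- **An imaginary-quadric model system is solvable**: there are `z, w ∈ ℂ` with
`e^z + e^{i z w} = z` and `e^w + e^{i z w} = w`. Base `x₃ = i x₁ x₂` (even degree, leading form
with imaginary values on `ℝ²`, so `Re g₂(2πi q) = 0` for every `q ∈ ℤ²`); `q = (1,1)`,
`A₁ = z`, `A₂ = w`, `F₁ = F₂ = -1`, `κ = Re(i · 2πi) + Re(i · 2πi) = -4π < 0`. New.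
[cite: MantovaMasser2023, §1 p.5 (the open case dim π(V) = 2 in ℂ³×ℂˣ³)] -/
theorem imaginary_quadric_model_system_solvable :
    ∃ z w : ℂ, exp z + exp (I * z * w) = z ∧ exp w + exp (I * z * w) = w := by
  set g : MvPolynomial (Fin 2) ℂ := C I * X 0 * X 1 with hg
  have hhom : g.IsHomogeneous 2 :=
    ((isHomogeneous_C (Fin 2) I).mul (isHomogeneous_X ℂ 0)).mul (isHomogeneous_X ℂ 1)
  have heval : ∀ x : Fin 2 → ℂ, eval x g = I * x 0 * x 1 := fun x => by
    simp [hg, map_mul, eval_X, eval_C]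
  have hg0 : g ≠ 0 := by
    intro h
    have h1 := heval ![1, 1]
    rw [h, map_zero] at h1
    simp only [Matrix.cons_val_zero, Matrix.cons_val_one, Matrix.cons_val_fin_one, mul_one] at h1
    exact Complex.I_ne_zero h1.symm
  have hdeg : g.totalDegree = 2 := hhom.totalDegree hg0
  set q : Fin 2 → ℤ := ![1, 1] with hq
  have hv : (fun j : Fin 2 => 2 * (Real.pi : ℂ) * I * ((q j : ℤ) : ℂ)) =
      fun _ => 2 * Real.pi * I := by
    funext j; fin_cases j <;> simp [hq]
  set A : Fin 2 → MvPolynomial (Fin 2) ℂ := ![X 0, X 1] with hAdef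
  have hA0 : A 0 = X 0 := by simp [hAdef]
  have hA1 : A 1 = X 1 := by simp [hAdef]
  have hdegA0 : (A 0).totalDegree = 1 := by rw [hA0, totalDegree_X]
  have hdegA1 : (A 1).totalDegree = 1 := by rw [hA1, totalDegree_X]
  have hA : ∀ j, eval (fun i => 2 * Real.pi * I * ((q i : ℤ) : ℂ))
      (homogeneousComponent (A j).totalDegree (A j)) ≠ 0 := by
    rw [hv]
    refine Fin.forall_fin_two.mpr ⟨?_, ?_⟩
    · rw [hdegA0, hA0, homogeneousComponent_eq_self (isHomogeneous_X ℂ 0), eval_X]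
      exact Complex.two_pi_I_ne_zero
    · rw [hdegA1, hA1, homogeneousComponent_eq_self (isHomogeneous_X ℂ 1), eval_X]
      exact Complex.two_pi_I_ne_zero
  have hIpi : I * (2 * (Real.pi : ℂ) * I) = ((-2 * Real.pi : ℝ) : ℂ) := by
    push_cast; ring_nf; rw [Complex.I_sq]; ring
  have hre : (eval (fun j => 2 * Real.pi * I * ((q j : ℤ) : ℂ))
      (homogeneousComponent g.totalDegree g)).re = 0 := by
    rw [hv, hdeg, homogeneousComponent_eq_self hhom, heval, hIpi, Complex.re_ofReal_mul]
    simp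
  -- the partial derivatives of `g` at `2πi q`
  have hpd0 : eval (fun _ : Fin 2 => 2 * (Real.pi : ℂ) * I) (pderiv 0 g) =
      I * (2 * Real.pi * I) := by
    have h : pderiv 0 g = C I * X 1 := by
      rw [hg, pderiv_mul, pderiv_C_mul, pderiv_X_self,
        pderiv_X_of_ne (show (1 : Fin 2) ≠ 0 by decide)]
      simp
    rw [h, map_mul, eval_C, eval_X]
  have hpd1 : eval (fun _ : Fin 2 => 2 * (Real.pi : ℂ) * I) (pderiv 1 g) =
      I * (2 * Real.pi * I) := by
    have h : pderiv 1 g = C I * X 0 := by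
      rw [hg, pderiv_mul, pderiv_C_mul, pderiv_X_self,
        pderiv_X_of_ne (show (0 : Fin 2) ≠ 1 by decide)]
      simp
    rw [h, map_mul, eval_C, eval_X]
  have hκ : ∑ j, ((A j).totalDegree : ℝ) * (eval (fun i => 2 * Real.pi * I * ((q i : ℤ) : ℂ))
      (pderiv j (homogeneousComponent g.totalDegree g))).re < 0 := by
    rw [hv, hdeg, homogeneousComponent_eq_self hhom, Fin.sum_univ_two, hdegA0, hdegA1, hpd0,
      hpd1, hIpi, Complex.ofReal_re]
    have := Real.pi_pos
    push_cast
    linarith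
  obtain ⟨x, hx⟩ := exists_solution_oscillatory g (by rw [hdeg]) q hre A hA hκ (fun _ => C (-1))
  refine ⟨x 0, x 1, ?_, ?_⟩
  · have h := hx 0
    rw [heval, eval_C, hA0, eval_X] at h
    linear_combination h
  · have h := hx 1
    rw [heval, eval_C, hA1, eval_X] at h
    linear_combination h

end Summit.Schanuel.Schanuel.Theorems
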